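import Summits.CriticalPhenomena.SAWScalingLimit.Theses.SAWSpinMonotone
import Summits.CriticalPhenomena.SAWScalingLimit.Theorems.SAWSpinMonotoneArrivalFlatteningSpinChordDefs
import Summits.CriticalPhenomena.SAWScalingLimit.Theorems.SAWSpinMonotoneArrivalFlatteningExitSpinBound

/-!
# The reduction of line `spin-chord`: `ThreeSpinChord → SpinMonotonePair → ThroughMassDecay → ArrivalFlattening`

Crux `stmt-CriticalPhenomena-16770` (`Summit.CriticalPhenomena.SAWScalingLimit.Theses.SAWSpinMonotone.ArrivalFlattening`, route
`SAWSpinMonotone`, rank 3), line `spin-chord` (skeleton `Cruxes/ArrivalFlattening/Lines/spin_chord.lean`), lead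
`prover-line-stmt-CriticalPhenomena-16770-0`, cycle 1. This file lands, sorry-free, the COMPOSITION of the line over the vocabulary
module `…SpinChordDefs` (p165751) and the landed exit-spin bound `stub_exitSpinBound : ExitSpinBound` (p166590):

* `monopoleDecay_of : SpinMonotonePair → ExitSpinBound → ThroughMassDecay → MonopoleDecay` — the exit chain
  `‖A(5/8)‖ ≤ ‖A(3/8)‖ ≤ ThroughMass ≤ η ‖A(0)‖` at depth `max (max R₂ 1) R(η)`;
* `flatLimit_of : ThreeSpinChord → MonopoleDecay → (ε–R flattening)` — `η = ε^{1/K}`, the elementary `chord_step`, degenerate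
  masses by the mass domination `norm_arrivalTransform_le` of the Defs module;
* `arrivalFlattening_of_stubs : ThreeSpinChord → SpinMonotonePair → ThroughMassDecay → ArrivalFlattening` (registered glue
  sub-goal of the crux; S3 is discharged inside by the landed theorem) and the two-hypothesis form
  `arrivalFlattening_of_chord_of_monopoleDecay : ThreeSpinChord → MonopoleDecay → ArrivalFlattening`;
* `spinMonotonePair_of_spinMonotone : SpinMonotone → SpinMonotonePair` (the `(3/8, 5/8)` instance of the route's rank-2 crux,
  stmt-CriticalPhenomena-16769) and hence `arrivalFlattening_of_spinMonotone : SpinMonotone → ThreeSpinChord → ThroughMassDecay →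
  ArrivalFlattening` — the crux CONDITIONAL on the sister crux and the two conjecture-grade stubs of the line.

All four crux-concluding theorems are CONDITIONAL results (their hypotheses `ThreeSpinChord`, `SpinMonotonePair` /
`SpinMonotone`, `ThroughMassDecay`, `MonopoleDecay` are open statements of the line / the route, not facts); they credit nothing
toward the item and exist so that a planner promoting the stubs to route items has the glue kernel-checked in the tree.
Sources: the line card `Cruxes/ArrivalFlattening/Lines/spin-chord.md`; H. Duminil-Copin, S. Smirnov, Ann. of Math. 175 (2012)
(arXiv:1007.0575), Definition 1 (the observable). Deliberately NOT here: any claim about the open stubs themselves.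
-/

noncomputable section

namespace Summit.CriticalPhenomena.SAWScalingLimit.Cruxes.ArrivalFlattening.SpinChord

open Literature.Probability.LatticeModels
open Literature.Probability.RandomPlanarGeometry Literature.Probability.RandomPlanarGeometry.SAW
open Summit.CriticalPhenomena.SAWScalingLimit.Theses.SAWSpinMonotone (ArrivalFlattening SpinMonotone)

/-! ## 1. The crux in the line's vocabulary -/

/-- The crux in the line's vocabulary (definitional: the crux's `let G := …` ζ-reduces, `arrivalTransform` δ-reduces). -/
theorem arrivalFlattening_iff_atDepth :
    ArrivalFlattening ↔ ∀ ε : ℝ, 0 < ε → ∃ R : ℝ, AtDepth R (fun Λ a v w₀ w₁ w₂ =>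
      ‖arrivalTransform Λ a v w₀ w₁ w₂ (11 / 8)‖ ≤ ε * ‖arrivalTransform Λ a v w₀ w₁ w₂ (5 / 8)‖) :=
  Iff.rfl

/-! ## 2. The composition -/

/-- `AtDepth` is monotone in the depth (a deeper ball condition constrains fewer configurations). [folklore] -/
theorem atDepth_mono {R R' : ℝ} (hR : R ≤ R')
    {P : Finset HexVertex → Sym2 HexVertex → HexVertex → HexVertex → HexVertex → HexVertex → Prop}
    (h : AtDepth R P) : AtDepth R' P := by
  intro Λ hΛ a ha v hv hball w₀ w₁ w₂ h₀ h₁ h₂ n₁ n₂ n₃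
  exact h Λ hΛ a ha v hv (fun w hw => hball w (hw.trans hR)) w₀ w₁ w₂ h₀ h₁ h₂ n₁ n₂ n₃

/-- The elementary real inequality behind the composition: from the chord `x · m^K ≤ y^{1+K}`, the decay `y ≤ η m`,
`η^K = ε` and the domination `x ≤ m`, conclude `x ≤ ε y` (all quantities non-negative, `K > 0`). [folklore] -/
theorem chord_step {x y m K η ε : ℝ} (hx : 0 ≤ x) (hy : 0 ≤ y) (hm : 0 ≤ m) (hK : 0 < K) (hε : 0 ≤ ε)
    (hηK : η ^ K = ε)
    (hchord : x * m ^ K ≤ y ^ (1 + K)) (hdecay : y ≤ η * m) (hdom : x ≤ m) : x ≤ ε * y := by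
  rcases hm.eq_or_lt with hm0 | hmpos
  · -- no mass: everything vanishes
    have hx0 : x = 0 := le_antisymm (hm0 ▸ hdom) hx
    rw [hx0]; positivity
  have hmK : 0 < m ^ K := Real.rpow_pos_of_pos hmpos K
  rcases hy.eq_or_lt with hy0 | hypos
  · -- `y = 0`: the chord forces `x = 0`
    have h1K : (1 + K) ≠ 0 := by linarith
    have h0 : x * m ^ K ≤ 0 := by simpa [← hy0, Real.zero_rpow h1K] using hchord
    have hx0 : x ≤ 0 := le_of_mul_le_mul_right (by simpa using h0) hmK
    have : x = 0 := le_antisymm hx0 hx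
    rw [this]; positivity
  -- main case: `x ≤ y^{1+K}/m^K = y (y/m)^K ≤ y η^K = ε y`
  have hratio : y / m ≤ η := by rwa [div_le_iff₀ hmpos]
  have hpow : (y / m) ^ K ≤ η ^ K := Real.rpow_le_rpow (div_nonneg hy hm) hratio hK.le
  have hsplit : y ^ (1 + K) = y * (y / m) ^ K * m ^ K := by
    rw [Real.rpow_add hypos, Real.rpow_one, Real.div_rpow hy hm, mul_assoc,
      div_mul_cancel₀ _ hmK.ne']
  have hle : x * m ^ K ≤ (y * (y / m) ^ K) * m ^ K := by rw [← hsplit]; exact hchord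
  have hx' : x ≤ y * (y / m) ^ K := le_of_mul_le_mul_right hle hmK
  calc x ≤ y * (y / m) ^ K := hx'
    _ ≤ y * η ^ K := mul_le_mul_of_nonneg_left hpow hy
    _ = ε * y := by rw [hηK, mul_comm]

/-- **`monopoleDecay_of`** — (P) + (E) + (T) give (D): at depth `max (max R₂ 1) R(η)`,
`‖A(5/8)‖ ≤ ‖A(3/8)‖ ≤ ThroughMass ≤ η ‖A(0)‖`. -/
theorem monopoleDecay_of (hP : SpinMonotonePair) (hE : ExitSpinBound) (hT : ThroughMassDecay) : MonopoleDecay := by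
  intro η hη
  obtain ⟨R₂, hpair⟩ := hP
  obtain ⟨R₃, hthr⟩ := hT η hη
  refine ⟨max (max R₂ 1) R₃, ?_⟩
  intro Λ hΛ a ha v hv hball w₀ w₁ w₂ h₀ h₁ h₂ n₁ n₂ n₃
  have hp := atDepth_mono ((le_max_left R₂ 1).trans (le_max_left _ R₃)) hpair
    Λ hΛ a ha v hv hball w₀ w₁ w₂ h₀ h₁ h₂ n₁ n₂ n₃
  have he := atDepth_mono ((le_max_right R₂ 1).trans (le_max_left _ R₃)) hE
    Λ hΛ a ha v hv hball w₀ w₁ w₂ h₀ h₁ h₂ n₁ n₂ n₃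
  have ht := atDepth_mono (le_max_right (max R₂ 1) R₃) hthr
    Λ hΛ a ha v hv hball w₀ w₁ w₂ h₀ h₁ h₂ n₁ n₂ n₃
  exact hp.trans (he.trans ht)

/-- **`flatLimit_of`** — the composition in the line's vocabulary: chord (C) + monopole decay (D) give the `ε–R`
flattening.  `η := ε^{1/K}`, `R := max R₁ R₂`. -/
theorem flatLimit_of (hC : ThreeSpinChord) (hD : MonopoleDecay) :
    ∀ ε : ℝ, 0 < ε → ∃ R : ℝ, AtDepth R (fun Λ a v w₀ w₁ w₂ =>
      ‖arrivalTransform Λ a v w₀ w₁ w₂ (11 / 8)‖ ≤ ε * ‖arrivalTransform Λ a v w₀ w₁ w₂ (5 / 8)‖) := by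
  intro ε hε
  obtain ⟨K, R₁, hK, hchord⟩ := hC
  have hηpos : 0 < ε ^ (1 / K) := Real.rpow_pos_of_pos hε _
  have hηK : (ε ^ (1 / K)) ^ K = ε := by
    rw [← Real.rpow_mul hε.le, one_div_mul_cancel hK.ne', Real.rpow_one]
  obtain ⟨R₂, hdecay⟩ := hD (ε ^ (1 / K)) hηpos
  refine ⟨max R₁ R₂, ?_⟩
  intro Λ hΛ a ha v hv hball w₀ w₁ w₂ h₀ h₁ h₂ n₁ n₂ n₃
  have hc := atDepth_mono (le_max_left R₁ R₂) hchord Λ hΛ a ha v hv hball w₀ w₁ w₂ h₀ h₁ h₂ n₁ n₂ n₃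
  have hd := atDepth_mono (le_max_right R₁ R₂) hdecay Λ hΛ a ha v hv hball w₀ w₁ w₂ h₀ h₁ h₂ n₁ n₂ n₃
  exact chord_step (norm_nonneg _) (norm_nonneg _) (norm_nonneg _) hK hε.le hηK hc hd
    (norm_arrivalTransform_le Λ a v w₀ w₁ w₂ (11 / 8))

/-! ## 3. The crux from the stubs (conditional results) -/

/-- **Registered glue sub-goal `arrivalFlattening_of_stubs`**: the three open stubs of the line imply the crux — S3
`ExitSpinBound` being the landed theorem `stub_exitSpinBound`. CONDITIONAL on `ThreeSpinChord`, `SpinMonotonePair`,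
`ThroughMassDecay` (open). -/
theorem arrivalFlattening_of_stubs : ThreeSpinChord → SpinMonotonePair → ThroughMassDecay →
    Summit.CriticalPhenomena.SAWScalingLimit.Theses.SAWSpinMonotone.ArrivalFlattening :=
  fun h1 h2 h4 => arrivalFlattening_iff_atDepth.mpr (flatLimit_of h1 (monopoleDecay_of h2 stub_exitSpinBound h4))

/-- The two-hypothesis composition: chord + monopole decay give the crux (for a prover who closes `MonopoleDecay` otherwise,
e.g. by the cards `single-crossing-renewal` / `plancherel-under-fm`). CONDITIONAL on `ThreeSpinChord`, `MonopoleDecay`. -/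
theorem arrivalFlattening_of_chord_of_monopoleDecay (hC : ThreeSpinChord) (hD : MonopoleDecay) :
    Summit.CriticalPhenomena.SAWScalingLimit.Theses.SAWSpinMonotone.ArrivalFlattening :=
  arrivalFlattening_iff_atDepth.mpr (flatLimit_of hC hD)

/-- (P) follows from the route's rank-2 crux `SpinMonotone` (stmt-CriticalPhenomena-16769), with any `R₂`:
antitonicity of `s ↦ ‖A_v(s)‖` on `[0, 3/2]` at the two points `3/8 ≤ 5/8`. -/
theorem spinMonotonePair_of_spinMonotone (hFM : SpinMonotone) : SpinMonotonePair := by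
  refine ⟨0, ?_⟩
  intro Λ hΛ a ha v hv hball w₀ w₁ w₂ h₀ h₁ h₂ n₁ n₂ n₃
  have h := hFM Λ hΛ a ha v hv w₀ w₁ w₂ h₀ h₁ h₂ n₁ n₂ n₃
  have h38 : (3 / 8 : ℝ) ∈ Set.Icc (0 : ℝ) (3 / 2) := ⟨by norm_num, by norm_num⟩
  have h58 : (5 / 8 : ℝ) ∈ Set.Icc (0 : ℝ) (3 / 2) := ⟨by norm_num, by norm_num⟩
  have hle := h h38 h58 (by norm_num)
  simpa [arrivalTransform] using hle

/-- **The crux conditional on the sister crux**: `SpinMonotone` (stmt-CriticalPhenomena-16769) together with the two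
conjecture-grade stubs `ThreeSpinChord`, `ThroughMassDecay` of the line gives `ArrivalFlattening`. CONDITIONAL. -/
theorem arrivalFlattening_of_spinMonotone (hFM : SpinMonotone) (hC : ThreeSpinChord) (hT : ThroughMassDecay) :
    Summit.CriticalPhenomena.SAWScalingLimit.Theses.SAWSpinMonotone.ArrivalFlattening :=
  arrivalFlattening_of_stubs hC (spinMonotonePair_of_spinMonotone hFM) hT

end Summit.CriticalPhenomena.SAWScalingLimit.Cruxes.ArrivalFlattening.SpinChord

end
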